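import Mathlib.Analysis.SpecialFunctions.Pow.Real
import Literature.Analysis.FunctionSpaces.FlatTorus
import Literature.Analysis.FunctionSpaces.TorusCalculus
import Literature.Analysis.FunctionSpaces.TorusSobolevNorm
import Literature.Analysis.FunctionSpaces.HolderNorm
import Literature.Analysis.FluidPDE.PassiveScalar
import HarnessLib

/-!
# The Alberti–Crippa–Mazzucato quasi-self-similar mixing family (Bruè–De Lellis 2023, Thm. 4.1;
Cheskidov 2023, Thm. 3.1)

Topic `Literature/Analysis/FluidPDE` (trunk FluidKinetic, family `turb`). This file vendors, as a
named fact, the *building block* on which the `2½`-dimensional anomalous-dissipation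
constructions rest:

* Bruè–De Lellis, CMP 400 (2023), Thm. 1.1 — vendored as
  `Literature.Analysis.FluidPDE.brue_deLellis_anomalous_dissipation` (`AnomalousDissipation.lean`);
* Bruè–Colombo–Crippa–De Lellis–Sorella 2024 — `Literature.Analysis.FluidPDE.bccds_onsager_critical` (ibid.);
* Cheskidov, arXiv:2311.04182 (2023), Thm. 1.3 — `Literature.Analysis.FluidPDE.cheskidov_time_periodic_anomaly`
  (`ZerothLaw.lean`), whose printed proof (§6) periodises in time the total-dissipation-anomaly
  construction of its Thm. 2.1/§4, itself built from the family below (its Thm. 3.1).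

**The fact** (`Literature.Analysis.FluidPDE.alberti_crippa_mazzucato_family`): there is a sequence
`(ρ_n, v_n)_{n ∈ ℕ}` of smooth solutions of the transport equation `∂ₜρ_n + v_n·∇ρ_n = 0` on
`[0,1] × T²` with smooth divergence-free drifts `v_n`, frequencies `λ_n = 5^n`, such that
(a) `‖∂ₜ^k v_n‖_{L^∞(0,1; C^α(T²))} ≤ C(α,k) λ_n^{α-1}` for every `α ≥ 0`, `k ∈ ℕ`;
(b) `ρ_n(t)` has zero mean and `‖ρ_n(t)‖_{L²} = 1` for every `t ∈ [0,1]`, and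
`‖ρ_n(t)‖_{L^∞} ≤ 10`, `‖∇ρ_n(t)‖_{L^∞} ≤ C λ_n`, `‖ρ_n(t)‖_{Ḣ⁻¹} ≤ C λ_n⁻¹` for an absolute
constant `C`; (c) for every `n` there is a compact `K_n ⊂ (0,1)²` with
`supp v_n(t) ∪ supp ρ_n(t) ⊂ K_n` for all `t ∈ [0,1]`; (d) `ρ_n(1) = ρ_{n+1}(0)`. This is
Bruè–De Lellis 2023, Thm. 4.1 (a)–(d) (stated on `[0,1]²`; item (c), read per level — see
"Deprecated" below for why — is what makes the `1`-periodic extension to `T²`, used from their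
§5 on, smooth), restated on `T²` as in Cheskidov 2023, Thm. 3.1 (which prints (a), (b), (d));
the construction is Alberti–Crippa–Mazzucato, JAMS 32 (2019) (Thms. 8 and 19 with the geometric
constructions of §§4–8). The explicit patching formula (BDL (4.3)–(4.4)) is *not* vendored (a
weaker statement); item (c) is kept because it yields the zero mean of the (divergence-free,
compactly supported) drifts `v_n(t)`, needed for the mean-zero clauses of the turbulence
statements; the convective estimate BDL (4.10), `‖∂ₜ^k (v_n·∇v_n)‖_{C([0,1];C^α)} ≤ C(α,k) λ_n^{α-1}`
for `α > 0`, which BDL derive from the patching structure, is vendored as a separate conjunct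
since it is used as such downstream (BDL Lemma 5.1; Cheskidov §3, convergence `g^m → g`).

## Lean rendering (design choices)

* Fields are time-first, `ρ : ℕ → ℝ → T² → ℝ`, `v : ℕ → ℝ → T² → ℝ²` with
  `T² = UnitAddTorus (Fin 2)`, `ℝ² = EuclideanSpace ℝ (Fin 2)`; "smooth solution of the transport
  equation with smooth divergence-free drift on `[0,1] × T²`" is the accepted
  `Torus.IsClassicalScalarTransportOn (Icc 0 1) 0 (v n) (ρ n)` (`PassiveScalar.lean`, diffusivity
  `κ = 0`, one-sided time derivative within `[0,1]`, joint `C^∞` of drift and scalar on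
  `[0,1] × T²`, `div v_n(t) = 0`).
* `C^α(T²)` for `α = j + r`, `j ∈ ℕ`, `r ∈ [0,1)`: the accepted `Torus.eContDiffHolderNorm j r`
  (`HolderNorm.lean`: `∑_{i ≤ j} ‖Dⁱ f‖_∞ + [Dʲ f]_r` of the periodic lift; for `r = 0` Mathlib's
  `0`-Hölder seminorm is the oscillation, so `C^{j,0} ≃ C^j` up to a factor `3`, absorbed in the
  constants). Every `α ≥ 0` is uniquely `j + r` with `r < 1`, so quantifying over `(j, r)`,
  `r < 1`, is the printed "every `α ≥ 0`"; the right-hand side is the real power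
  `5 ^ ((j + r - 1) n)`.
* `∂ₜ^k` of a time-dependent field at `t ∈ [0,1]` is `iteratedDerivWithin k (fun s => v n s x)
  (Icc 0 1) t` (one-sided at the endpoints, the convention of `Torus.timeDerivWithin`).
* `‖∇ρ‖_{L^∞}`, `‖ρ‖_{L^∞}` of smooth functions are pointwise bounds (`Torus.gradient`);
  `‖ρ‖_{L²}² = ∫ ρ²` (`= Torus.scalarL2Sq`); zero mean is `Torus.HasZeroMean`.
* `Ḣ⁻¹(T²)`: the accepted `Torus.eHomSobolevSeminorm (-1)` of `ρ` viewed in `ℂ`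
  (`(∑_{k ≠ 0} |k|⁻² |ρ̂(k)|²)^{1/2}`, characters `e^{2πi k·x}`); this is `2π` times the seminorm
  with the dimensional factor `(2π|k|)⁻²`, a harmless absolute factor in (b).
* Item (c) on the torus: `K_n` is a compact subset of the open unit square of `ℝ²`
  (`{y | ∀ i, y i ∈ Ioo 0 1}`) and the fields vanish at `proj y` for all `y` of the accepted
  fundamental cube `Torus.unitCube (Fin 2) = [0,1)²` outside `K_n`.
* Nothing is asserted for `t ∉ [0,1]` (values there are irrelevant junk of the witnesses).

## Deprecated (2026-08-16): the `n`-uniform reading of BDL Thm. 4.1 (c)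

`alberti_crippa_mazzucato_quasi_self_similar` (the first rendering of this fact) reads BDL (c)
with its printed quantifier order, ONE compact `K ⊂ (0,1)²` for all `n`. That statement is not
proved by any of its sources and is inconsistent with the structure BDL's own Thm. 4.1 asserts:
by (4.3), `ρ_n(·,t)|_Q = Θ_{i(Q)}(2·5ⁿ(· - r(Q)), t)` for EVERY square `Q` of the tiling
`𝒬(2·5ⁿ)` of `[0,1]²`, and by (ii) each `Θ_i(·,t)` has unit `L²((0,1)²)`-mass, so
`∫_Q ρ_n(·,t)² = (2·5ⁿ)⁻² > 0` on each of the `4·25ⁿ` squares, in particular on those adjacent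
to `∂[0,1]²`; hence `dist(supp ρ_n(·,t), ∂[0,1]²) ≤ diam Q = √2 (2·5ⁿ)⁻¹ → 0`, while a compact
`K ⊂ (0,1)²` has positive distance from `∂[0,1]²`. What the source of the construction proves is
the per-level statement (Alberti–Crippa–Mazzucato 2019, Thm. 19: "`u` and `ρ` are supported in
`Q` for all times"; §8.5 (a): at scale `ℓ(t)` the fields live in tubes `B(Γ(t), 2r/ℓ(t))`;
§8.6: "the velocity field `u` vanishes in a neighborhood of the boundary of `Q`"), and this is
all that is used downstream (BDL §5, first paragraph: the `1`-periodic extension to `T²` is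
smooth; Cheskidov 2023, §3: the drifts have zero mean); Cheskidov's Thm. 3.1 does not print (c)
at all. The old declaration is kept verbatim (it has in-tree users, all of which only use it
through `alberti_crippa_mazzucato_quasi_self_similar.family`) and deprecated in favour of
`alberti_crippa_mazzucato_family`; whether some *other* family satisfies the uniform clause is
not addressed in the literature, so no `_holds` theorem can be vendored for it.

## Status of the fact (2026-08): reduction to the geometry

* `alberti_crippa_mazzucato_family` is PROVED from the purely geometric fact
  `acm_building_blocks` (`QuasiSelfSimilarBuildingBlocks.lean`: existence of the building blocks
  of BDL §4.1 whose patches (4.3)–(4.4) are smooth, supported in the open square at each level,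
  and hand over) in `QuasiSelfSimilarFamilyProofs.lean`
  (`alberti_crippa_mazzucato_family_of_building_blocks`), the scaling analysis of ACM §6 /
  BDL Thm. 4.1 (a), (b), (4.10) being carried out in `QuasiSelfSimilarFamilyEstimates.lean`
  (with `TorusPatching`, `TorusPatchingCalculus`, `TorusCellwiseHNegOne`, `HolderInterpolation`,
  `SpaceTimeSliceDerivatives` in `FunctionSpaces/`). It also follows from the planar family
  `alberti_crippa_mazzucato_planar_family` (`QuasiSelfSimilarPlanar.lean`, BDL Thm. 4.1 on
  `[0,1] × ℝ²`) by periodisation (`alberti_crippa_mazzucato_family_of_planar`,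
  `QuasiSelfSimilarMixingProofs.lean`).
* `acm_building_blocks` is in turn PROVED (`QuasiSelfSimilarCompatibleBlocksProofs.lean`:
  `acm_building_blocks_of_compatible_blocks`) from the finer kinematic fact
  `acm_compatible_blocks` (`QuasiSelfSimilarCompatibleBlocks.lean`: finitely many smooth
  incompressible blocks with gates, a child/seed labelling rule and one standard gate field per
  axis, ACM §8.1, §8.4 (a)–(c), §8.5): the quasi-self-similar induction of ACM §6.2 (labels
  `QuasiSelfSimilar.blockLabel`), the smooth gluing across interfaces of ACM §8.6–8.8
  (`FunctionSpaces/TorusPatchingGlue.lean`), the per-level supports, the hand-over and the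
  conservation of mean and mass (`BoxTransportConservation.lean`) are theorems; the symmetries of
  the square acting on blocks (`QuasiSelfSimilarSymmetry.lean`, `QuasiSelfSimilarGenerators.lean`,
  `QuasiSelfSimilarGeneratorMoves.lean`) reduce it further to the generating moves of the Peano
  snake, whose curves the source gives only by figures (ACM §8.9–8.11).

## References

* G. Alberti, G. Crippa, A. L. Mazzucato, *Exponential self-similar mixing by incompressible
  flows*, J. Amer. Math. Soc. 32 (2019), 445–490, Thms. 8, 19, §§4–8, in particular §8.5 (a),
  §8.6 (arXiv:1605.02090, pp. 20, 26–27).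
* E. Bruè, C. De Lellis, *Anomalous dissipation for the forced 3D Navier–Stokes equations*,
  Comm. Math. Phys. 400 (2023), 1507–1533, §4: (ii), Thm. 4.1 (a)–(d) with (4.3)–(4.4),
  eq. (4.10) (arXiv:2207.06301, p. 9).
* A. Cheskidov, *Dissipation anomaly and anomalous dissipation in incompressible fluid flows*,
  arXiv:2311.04182 (2023), Thm. 3.1 (p. 10).
-/

noncomputable section

open MeasureTheory Set Filter Topology
open scoped NNReal ENNReal

namespace Literature.Analysis.FluidPDE

/-- **Quasi-self-similar mixing family, per-level supports** (Alberti–Crippa–Mazzucato 2019,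
§§6–8; as printed in Bruè–De Lellis, CMP 400 (2023), Thm. 4.1 (a), (b), (d), eq. (4.10), with
item (c) in its consistent per-level reading, and in Cheskidov, arXiv:2311.04182, Thm. 3.1, with
`λ_n = 5^n`). There exist smooth solutions `ρ_n ∈ C^∞([0,1] × T²)` of the transport equation
`∂ₜρ_n + v_n·∇ρ_n = 0` with smooth divergence-free drifts `v_n ∈ C^∞([0,1] × T²; ℝ²)`, `n ∈ ℕ`,
such that:
(a) for every `α = j + r ≥ 0` (`j ∈ ℕ`, `0 ≤ r < 1`) and `k ∈ ℕ` there is `C(α,k)` with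
`‖∂ₜ^k v_n(t)‖_{C^α(T²)} ≤ C(α,k) 5^{(α-1)n}` for all `n` and `t ∈ [0,1]`;
(BDL (4.10)) for every `α = j + r > 0` (`r < 1`) and `k` there is `C(α,k)` with
`‖∂ₜ^k (v_n·∇v_n)(t)‖_{C^α(T²)} ≤ C(α,k) 5^{(α-1)n}` for all `n`, `t ∈ [0,1]`;
(b) `∫ ρ_n(t) = 0`, `∫ ρ_n(t)² = 1` and `‖ρ_n(t)‖_{L^∞} ≤ 10` for all `n`, `t ∈ [0,1]`, and there
is an absolute constant `C` with `‖∇ρ_n(t)‖_{L^∞} ≤ C 5^n` and `‖ρ_n(t)‖_{Ḣ⁻¹} ≤ C 5^{-n}` for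
all `n`, `t ∈ [0,1]`;
(c) for every `n` there is a compact `K_n ⊂ (0,1)²` with `supp v_n(·,t) ∪ supp ρ_n(·,t) ⊂ K_n`
for all `t ∈ [0,1]` (on the torus: `v_n(t)` and `ρ_n(t)` vanish at `proj y` for every `y` of the
fundamental cube `[0,1)²` outside `K_n`) — in particular the divergence-free `v_n(t)` have zero
mean;
(d) `ρ_n(1) = ρ_{n+1}(0)` for every `n`.
See the module docstring for the rendering of the norms (`Torus.eContDiffHolderNorm`,
`Torus.eHomSobolevSeminorm (-1)`, one-sided `iteratedDerivWithin` in time), for what is not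
vendored (the patching formulas BDL (4.3)–(4.4)), and ("Deprecated") for why item (c) is read per
level and not with the `n`-uniform compact set printed in BDL (c).
[cite: BrueDeLellisCMP2023, Thm. 4.1 and (4.10)] [cite: Cheskidov2023, Thm. 3.1] [cite: AlbertiCrippaMazzucato2019, Thm. 19, §8.5 (a), §8.6] -/
def alberti_crippa_mazzucato_family : Prop :=
  ∃ (ρ : ℕ → ℝ → UnitAddTorus (Fin 2) → ℝ)
    (v : ℕ → ℝ → UnitAddTorus (Fin 2) → EuclideanSpace ℝ (Fin 2)),
    (∀ n, Torus.IsClassicalScalarTransportOn (Icc 0 1) 0 (v n) (ρ n)) ∧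
    (∀ (j k : ℕ) (r : ℝ≥0), r < 1 → ∃ C : ℝ, ∀ n : ℕ, ∀ t ∈ Icc (0 : ℝ) 1,
      FunctionSpaces.Torus.eContDiffHolderNorm j r
          (fun x => iteratedDerivWithin k (fun s => v n s x) (Icc 0 1) t) ≤
        ENNReal.ofReal (C * (5 : ℝ) ^ (((j : ℝ) + r - 1) * n))) ∧
    (∀ (j k : ℕ) (r : ℝ≥0), r < 1 → 0 < (j : ℝ) + r → ∃ C : ℝ, ∀ n : ℕ, ∀ t ∈ Icc (0 : ℝ) 1,
      FunctionSpaces.Torus.eContDiffHolderNorm j r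
          (fun x => iteratedDerivWithin k
            (fun s => FunctionSpaces.Torus.convect (v n s) (v n s) x) (Icc 0 1) t) ≤
        ENNReal.ofReal (C * (5 : ℝ) ^ (((j : ℝ) + r - 1) * n))) ∧
    (∀ n : ℕ, ∀ t ∈ Icc (0 : ℝ) 1,
      FunctionSpaces.Torus.HasZeroMean (ρ n t) ∧ ∫ x, ρ n t x ^ 2 = 1 ∧ ∀ x, |ρ n t x| ≤ 10) ∧
    (∃ C : ℝ, ∀ n : ℕ, ∀ t ∈ Icc (0 : ℝ) 1,
      (∀ x, ‖FunctionSpaces.Torus.gradient (ρ n t) x‖ ≤ C * 5 ^ n) ∧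
      FunctionSpaces.Torus.eHomSobolevSeminorm (-1) (fun x => (ρ n t x : ℂ)) ≤
        ENNReal.ofReal (C * (5 ^ n)⁻¹)) ∧
    (∀ n : ℕ, ∃ K : Set (EuclideanSpace ℝ (Fin 2)), IsCompact K ∧
      K ⊆ {y | ∀ i, y i ∈ Ioo (0 : ℝ) 1} ∧
      ∀ t ∈ Icc (0 : ℝ) 1, ∀ y ∈ FunctionSpaces.Torus.unitCube (Fin 2), y ∉ K →
        v n t (FunctionSpaces.Torus.proj y) = 0 ∧ ρ n t (FunctionSpaces.Torus.proj y) = 0) ∧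
    (∀ n : ℕ, ρ n 1 = ρ (n + 1) 0)

/-- The initial datum `ρ_in := ρ_1(0)` of the Bruè–De Lellis / Cheskidov constructions from the
per-level family (Cheskidov 2023, (3.2); any `ρ_n(0)` would do): a smooth mean-zero scalar on
`T²` with `‖ρ_in‖_{L²} = 1` and `‖ρ_in‖_{L^∞} ≤ 10` (time slice of a jointly smooth field,
`Torus.IsSmoothSpaceTimeOn.isSmooth_slice`). [cite: Cheskidov2023, (3.2)] -/
theorem alberti_crippa_mazzucato_family.exists_datum (h : alberti_crippa_mazzucato_family) :
    ∃ ρin : UnitAddTorus (Fin 2) → ℝ,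
      FunctionSpaces.Torus.IsSmooth ρin ∧ FunctionSpaces.Torus.HasZeroMean ρin ∧
      ∫ x, ρin x ^ 2 = 1 ∧ ∀ x, |ρin x| ≤ 10 := by
  obtain ⟨ρ, v, hsol, -, -, hb, -, -, -⟩ := h
  have h0 : (0 : ℝ) ∈ Icc (0 : ℝ) 1 := ⟨le_rfl, zero_le_one⟩
  obtain ⟨hmean, hL2, hsup⟩ := hb 1 0 h0
  exact ⟨ρ 1 0, (hsol 1).smooth_scalar.isSmooth_slice h0, hmean, hL2, hsup⟩

/-- Handover along the per-level family: `ρ_{n+1}(0) = ρ_n(1)`, and all slices `ρ_n(0)` have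
zero mean and unit `L²` norm (BDL 2023, Thm. 4.1 (b), (d)). [cite: BrueDeLellisCMP2023, Thm. 4.1] -/
theorem alberti_crippa_mazzucato_family.handover (h : alberti_crippa_mazzucato_family) :
    ∃ (ρ : ℕ → ℝ → UnitAddTorus (Fin 2) → ℝ)
      (v : ℕ → ℝ → UnitAddTorus (Fin 2) → EuclideanSpace ℝ (Fin 2)),
      (∀ n, Torus.IsClassicalScalarTransportOn (Icc 0 1) 0 (v n) (ρ n)) ∧
      (∀ n, ρ (n + 1) 0 = ρ n 1) ∧
      ∀ n, FunctionSpaces.Torus.HasZeroMean (ρ n 0) ∧ ∫ x, ρ n 0 x ^ 2 = 1 := by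
  obtain ⟨ρ, v, hsol, -, -, hb, -, -, hd⟩ := h
  have h0 : (0 : ℝ) ∈ Icc (0 : ℝ) 1 := ⟨le_rfl, zero_le_one⟩
  exact ⟨ρ, v, hsol, fun n => (hd n).symm, fun n => ⟨(hb n 0 h0).1, (hb n 0 h0).2.1⟩⟩

/-- The per-level supports already give what the turbulence statements use from item (c): the
divergence-free drifts `v_n(t)`, `t ∈ [0,1]`, vanish on the image of the boundary of the
fundamental cube (where `y ∉ K_n ⊂ (0,1)²`), in particular at the origin of `T²`.
[cite: BrueDeLellisCMP2023, Thm. 4.1 (c)] -/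
theorem alberti_crippa_mazzucato_family.velocity_apply_zero (h : alberti_crippa_mazzucato_family) :
    ∃ (ρ : ℕ → ℝ → UnitAddTorus (Fin 2) → ℝ)
      (v : ℕ → ℝ → UnitAddTorus (Fin 2) → EuclideanSpace ℝ (Fin 2)),
      (∀ n, Torus.IsClassicalScalarTransportOn (Icc 0 1) 0 (v n) (ρ n)) ∧
      (∀ n, ρ n 1 = ρ (n + 1) 0) ∧ ∀ n, ∀ t ∈ Icc (0 : ℝ) 1, v n t 0 = 0 := by
  obtain ⟨ρ, v, hsol, -, -, -, -, hc, hd⟩ := h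
  refine ⟨ρ, v, hsol, hd, fun n t ht => ?_⟩
  obtain ⟨K, -, hKsub, hK⟩ := hc n
  have h0cube : (0 : EuclideanSpace ℝ (Fin 2)) ∈ FunctionSpaces.Torus.unitCube (Fin 2) :=
    fun i => by simp
  have h0K : (0 : EuclideanSpace ℝ (Fin 2)) ∉ K := fun h0 => by
    simpa using (hKsub h0 0).1
  simpa using (hK t ht 0 h0cube h0K).1

/-! ## Deprecated: the `n`-uniform reading of BDL Thm. 4.1 (c)

See the module docstring, section "Deprecated (2026-08-16)". The declaration below is the first
rendering of the fact, with item (c) read as printed by Bruè–De Lellis ("there exists a compact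
set `K ⊂ (0,1)²` such that `supp v_n(·,t) ∪ supp ρ_n(·,t) ⊂ K` for any `n ∈ ℕ` and every
`t ∈ [0,1]`"), i.e. with ONE `K` for all `n`. It is kept verbatim, deprecated, because it still
has in-tree users (all through `alberti_crippa_mazzucato_quasi_self_similar.family`); new code
takes `(h : alberti_crippa_mazzucato_family)`. -/

/-- **Deprecated** (2026-08-16) — **mis-stated**; superseded by `alberti_crippa_mazzucato_family`
(above), which differs only in item (c): `∀ n, ∃ K_n` instead of `∃ K, ∀ n`. *What is wrong:* the
`n`-uniform support clause is the printed wording of Bruè–De Lellis 2023, Thm. 4.1 (c), but it is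
not proved by any source and contradicts the structure (4.3) + (ii) asserted by the same theorem
(every square of `𝒬(2·5ⁿ)` carries a rescaled block of `L²`-mass `(2·5ⁿ)⁻² > 0`, so
`dist(supp ρ_n(·,t), ∂[0,1]²) ≤ √2 (2·5ⁿ)⁻¹ → 0`, whereas a compact `K ⊂ (0,1)²` stays at
positive distance from `∂[0,1]²`); the construction (Alberti–Crippa–Mazzucato 2019, Thm. 19,
§8.5 (a), §8.6) gives per-level supports `K_n`, and Cheskidov 2023, Thm. 3.1 prints no support
clause. So no `_holds` theorem can be vendored for this statement, while the per-level statement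
is derived in the tree from the building blocks (`alberti_crippa_mazzucato_family_of_building_blocks`).
*Original content* (statement unchanged): items (a), (4.10), (b), (d) exactly as in
`alberti_crippa_mazzucato_family`, and (c) there is a compact `K ⊂ (0,1)²` with
`supp v_n(·,t) ∪ supp ρ_n(·,t) ⊂ K` for all `n`, `t ∈ [0,1]` (on the torus: `v_n(t)` and
`ρ_n(t)` vanish at `proj y` for every `y` in the fundamental cube `[0,1)²` outside `K`).
[cite: BrueDeLellisCMP2023, Thm. 4.1 with item (c) as printed — mis-stated, see the deprecation note; corrected as alberti_crippa_mazzucato_family] -/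
@[deprecated alberti_crippa_mazzucato_family (since := "2026-08-16")]
def alberti_crippa_mazzucato_quasi_self_similar : Prop :=
  ∃ (ρ : ℕ → ℝ → UnitAddTorus (Fin 2) → ℝ)
    (v : ℕ → ℝ → UnitAddTorus (Fin 2) → EuclideanSpace ℝ (Fin 2)),
    (∀ n, Torus.IsClassicalScalarTransportOn (Icc 0 1) 0 (v n) (ρ n)) ∧
    (∀ (j k : ℕ) (r : ℝ≥0), r < 1 → ∃ C : ℝ, ∀ n : ℕ, ∀ t ∈ Icc (0 : ℝ) 1,
      FunctionSpaces.Torus.eContDiffHolderNorm j r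
          (fun x => iteratedDerivWithin k (fun s => v n s x) (Icc 0 1) t) ≤
        ENNReal.ofReal (C * (5 : ℝ) ^ (((j : ℝ) + r - 1) * n))) ∧
    (∀ (j k : ℕ) (r : ℝ≥0), r < 1 → 0 < (j : ℝ) + r → ∃ C : ℝ, ∀ n : ℕ, ∀ t ∈ Icc (0 : ℝ) 1,
      FunctionSpaces.Torus.eContDiffHolderNorm j r
          (fun x => iteratedDerivWithin k
            (fun s => FunctionSpaces.Torus.convect (v n s) (v n s) x) (Icc 0 1) t) ≤
        ENNReal.ofReal (C * (5 : ℝ) ^ (((j : ℝ) + r - 1) * n))) ∧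
    (∀ n : ℕ, ∀ t ∈ Icc (0 : ℝ) 1,
      FunctionSpaces.Torus.HasZeroMean (ρ n t) ∧ ∫ x, ρ n t x ^ 2 = 1 ∧ ∀ x, |ρ n t x| ≤ 10) ∧
    (∃ C : ℝ, ∀ n : ℕ, ∀ t ∈ Icc (0 : ℝ) 1,
      (∀ x, ‖FunctionSpaces.Torus.gradient (ρ n t) x‖ ≤ C * 5 ^ n) ∧
      FunctionSpaces.Torus.eHomSobolevSeminorm (-1) (fun x => (ρ n t x : ℂ)) ≤
        ENNReal.ofReal (C * (5 ^ n)⁻¹)) ∧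
    (∃ K : Set (EuclideanSpace ℝ (Fin 2)), IsCompact K ∧ K ⊆ {y | ∀ i, y i ∈ Ioo (0 : ℝ) 1} ∧
      ∀ n : ℕ, ∀ t ∈ Icc (0 : ℝ) 1, ∀ y ∈ FunctionSpaces.Torus.unitCube (Fin 2), y ∉ K →
        v n t (FunctionSpaces.Torus.proj y) = 0 ∧ ρ n t (FunctionSpaces.Torus.proj y) = 0) ∧
    (∀ n : ℕ, ρ n 1 = ρ (n + 1) 0)

/-! The three bridge theorems below name the deprecated fact in their hypotheses; they are
deprecated themselves (so `linter.deprecated` stays silent inside them) and are kept only for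
the remaining users of `alberti_crippa_mazzucato_quasi_self_similar`. -/

/-- **Deprecated** (2026-08-16) with its hypothesis: use `alberti_crippa_mazzucato_family.exists_datum`.
*Content (unchanged):* the initial datum `ρ_in := ρ_1(0)` (Cheskidov 2023, (3.2)) read off the
`n`-uniform rendering — a smooth mean-zero scalar on `T²` with `‖ρ_in‖_{L²} = 1` and
`‖ρ_in‖_{L^∞} ≤ 10`. [cite: Cheskidov2023, (3.2)] -/
@[deprecated alberti_crippa_mazzucato_family.exists_datum (since := "2026-08-16")]
theorem alberti_crippa_mazzucato_quasi_self_similar.exists_datum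
    (h : alberti_crippa_mazzucato_quasi_self_similar) :
    ∃ ρin : UnitAddTorus (Fin 2) → ℝ,
      FunctionSpaces.Torus.IsSmooth ρin ∧ FunctionSpaces.Torus.HasZeroMean ρin ∧ ∫ x, ρin x ^ 2 = 1 ∧
      ∀ x, |ρin x| ≤ 10 := by
  obtain ⟨ρ, v, hsol, -, -, hb, -, -, -⟩ := h
  have h0 : (0 : ℝ) ∈ Icc (0 : ℝ) 1 := ⟨le_rfl, zero_le_one⟩
  obtain ⟨hmean, hL2, hsup⟩ := hb 1 0 h0
  exact ⟨ρ 1 0, (hsol 1).smooth_scalar.isSmooth_slice h0, hmean, hL2, hsup⟩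

/-- **Deprecated** (2026-08-16) with its hypothesis: use `alberti_crippa_mazzucato_family.handover`.
*Content (unchanged):* along the `n`-uniform rendering the scalar is handed over,
`ρ_{n+1}(0) = ρ_n(1)`, and all slices `ρ_n(0)` have zero mean and unit `L²` norm
(BDL 2023, Thm. 4.1 (b), (d)). [cite: BrueDeLellisCMP2023, Thm. 4.1] -/
@[deprecated alberti_crippa_mazzucato_family.handover (since := "2026-08-16")]
theorem alberti_crippa_mazzucato_quasi_self_similar.handover
    (h : alberti_crippa_mazzucato_quasi_self_similar) :
    ∃ (ρ : ℕ → ℝ → UnitAddTorus (Fin 2) → ℝ)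
      (v : ℕ → ℝ → UnitAddTorus (Fin 2) → EuclideanSpace ℝ (Fin 2)),
      (∀ n, Torus.IsClassicalScalarTransportOn (Icc 0 1) 0 (v n) (ρ n)) ∧
      (∀ n, ρ (n + 1) 0 = ρ n 1) ∧
      ∀ n, FunctionSpaces.Torus.HasZeroMean (ρ n 0) ∧ ∫ x, ρ n 0 x ^ 2 = 1 := by
  obtain ⟨ρ, v, hsol, -, -, hb, -, -, hd⟩ := h
  have h0 : (0 : ℝ) ∈ Icc (0 : ℝ) 1 := ⟨le_rfl, zero_le_one⟩
  exact ⟨ρ, v, hsol, fun n => (hd n).symm, fun n => ⟨(hb n 0 h0).1, (hb n 0 h0).2.1⟩⟩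

/-- **Deprecated** (2026-08-16) with its hypothesis: take `(h : alberti_crippa_mazzucato_family)`
directly. *Content (unchanged):* the `n`-uniform reading of BDL Thm. 4.1 (c) implies the per-level
one (take `K_n := K`) — the machine-checked record that the correction only weakens item (c), kept
for the remaining users of the deprecated fact. [cite: BrueDeLellisCMP2023, Thm. 4.1] -/
@[deprecated "the hypothesis `alberti_crippa_mazzucato_quasi_self_similar` is mis-stated \
(BDL Thm. 4.1 (c) with one compact set for all levels): take \
`(h : Literature.Analysis.FluidPDE.alberti_crippa_mazzucato_family)` directly" (since := "2026-08-16")]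
theorem alberti_crippa_mazzucato_quasi_self_similar.family
    (h : alberti_crippa_mazzucato_quasi_self_similar) : alberti_crippa_mazzucato_family := by
  obtain ⟨ρ, v, hsol, ha, ha', hb, hb', ⟨K, hK, hKsub, hKsupp⟩, hd⟩ := h
  exact ⟨ρ, v, hsol, ha, ha', hb, hb', fun n => ⟨K, hK, hKsub, fun t ht y hy hyK =>
    hKsupp n t ht y hy hyK⟩, hd⟩

end Literature.Analysis.FluidPDE

end
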